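import Summits.BirchSwinnertonDyer.BirchSwinnertonDyer.Theorems.Rank1ResidualX1Defs
import Summits.BirchSwinnertonDyer.Rank1Residual.X2.Cells
import HarnessLib

/-!
# K5 rung leaf — `EisensteinPrimes` (ladder BSD, rung K5; cell `bsd-eis`; D-0059 / D-0061)

The CLOSED `Prop` that ladder rung **K5 «Eisenstein primes»** targets, as the ladder words it
(`pub/ladder-directors/LADDER-BSD.md`: rows A1–A3 = class X1, A10 = X2b, B11 = X2c r1): Miller's
`BSD(E,p)` for EVERY elliptic curve `E/ℚ` of analytic rank `≤ 1` at EVERY odd Eisenstein prime `p`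
(`E[p]` reducible) that is either GOOD ANOMALOUS (class X1: `ClassX1 W p`) or MULTIPLICATIVE (class X2:
`ClassX2 W p`, `p ‖ N`). It is the conjunction of two closed class statements ALREADY typed in the tree,
nothing new is defined on the mathematics side:

* `Rank1ResidualX1Defs.BSDpOnClassX1` — `∀ W p, ClassX1 W p → analyticRank ≤ 1 → BSDp W p`
  (`Summits/BirchSwinnertonDyer/BirchSwinnertonDyer/Theorems/Rank1ResidualX1Defs.lean`); its TYPED
  INPUTS are Keller–Yin's `thm308_imc2_bdpValue_goodLattice_OPEN` (PREPRINT, the one binder left after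
  `X1.KellerYinTheoremA.forall_bsdp_classX1_typeA_rankOne`, rank 1 type A) and
  `MazurMainConjectureOnX1TypeA` (rank 0 type A; rank 1 type B through the twist partner);
* `X2.Target` — `∀ W p, analyticRank ≤ 1 → ClassX2 W p → BSDp W p`
  (`Summits/BirchSwinnertonDyer/Rank1Residual/X2/Cells.lean`) = `TargetA ∧ TargetB ∧ TargetC`
  (`X2.target_of_targets` / `X2.targets_of_target`), with `TargetA` (Greenberg–Vatsal cell) PROVED from
  published facts (`X2/RankZero.lean`), `TargetB` (rank 0, ¬(GV): typed input
  `X2.MazurMainConjectureAt W p`, «μ > 0 allowed») and `TargetC` (rank 1: `X2.RankOneDisplay` and the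
  `X2/ClassClosureO9.lean` sub-cells) OPEN.

The additive Eisenstein rows (X3 shares of B2/B6) are NOT part of this leaf: they ride on rung K1
(`AdditiveOrdinary`, cell `bsd-addord`) per the director's K5 formula «∀-closure of `X1.MissingInputAt`
∧ the X2 targets» (LADDER-BSD.md route table, row K5). `Typed.X1.MissingInputAt W p` and `BSDp W p` are
interchangeable on class X1 in rank `≤ 1` modulo published facts (`Typed.X1.bsdp_of_missingInputAt`,
`Typed.missingPPartAt_of_bsdp`), so the `BSDp` spelling is used: it is the PARTITION currency
(D-0054: a cell of `CornersAll` closes exactly when `BSDp` lands on it).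

STATEMENT ONLY — nothing is asserted; `@[conjecture]`; no section variables (`#check @EisensteinPrimes :
Prop`). The bookkeeping lemma below is proved (conjunction assembly), so that a route's deciding theorem
`closes : … → EisensteinPrimes` can end in `eisensteinPrimes_of_targets`; the converse split is
`⟨h.1, X2.targets_of_target h.2⟩`.
References: [KellerYin2024] Thm. 4.2.1 (p. 22), Thm. 3.0.8; [CastellaGrossiSkinner2025] (MC), Thm. A;
[GreenbergVatsal2000] Thm. 1.3; [Skinner2016PacificMC] Thm. A; [Miller2011LMS] Def. 1.1.
-/

set_option autoImplicit false

noncomputable section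

namespace Summit.BirchSwinnertonDyer.Rank1Residual.Eisenstein

open Summit.BirchSwinnertonDyer.BirchSwinnertonDyer.Theorems.Rank1ResidualX1Defs
  Summit.BirchSwinnertonDyer.Rank1Residual

/-- **Rung K5 leaf — BSD(E,p) at every odd Eisenstein prime of good-anomalous or multiplicative
reduction, analytic rank ≤ 1.** The conjunction of the closed class statements `BSDpOnClassX1`
(class X1: `2 < p`, `E[p]` reducible, good reduction, `a_p ≡ 1 (mod p)`; rows A1–A3) and `X2.Target`
(class X2: `p` odd, `E[p]` reducible, `p ‖ N`; rows A10 = X2b rank 0 ¬(GV), B11 = X2c rank 1, and the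
proved Greenberg–Vatsal cell X2a). OPEN; nothing asserted. [cite: KellerYin2024, Thm. 4.2.1 (p. 22)
(X1 part announced, preprint)] [cite: Skinner2016PacificMC, Thm. A (shape of the X2 input; nothing asserted)] -/
@[conjecture] def EisensteinPrimes : Prop :=
  BSDpOnClassX1 ∧ X2.Target

/-- Assembly of the leaf from its four cell targets (X1; X2a, X2b, X2c). [folklore] -/
theorem eisensteinPrimes_of_targets (h1 : BSDpOnClassX1) (hA : X2.TargetA) (hB : X2.TargetB)
    (hC : X2.TargetC) : EisensteinPrimes :=
  ⟨h1, X2.target_of_targets hA hB hC⟩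

end Summit.BirchSwinnertonDyer.Rank1Residual.Eisenstein

end

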